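import Literature.Geometry.Lorentzian.KillingChartJetRigidity
import HarnessLib

/-!
# Prolongation of the Killing equation with a source, and Grönwall propagation of jets

Topic `Literature/Geometry/Lorentzian`. Mathlib-level calculus on a finite-dimensional real normed
space `E`; everything is PROVED, no definition and no statement of `Prop` type is introduced.

`KillingChartJetRigidity.lean` runs the prolongation/ODE argument (O'Neill 1983, Ch. 9, Lemma 9.28)
on the homogeneous coordinate Killing equation `𝓛_X G = 0`. The first **Killing initial data (KID)**
equation (Moncrief 1975; Beig–Chruściel 1997) is the Killing equation WITH A SOURCE, `𝓛_X G = S`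
(`S = −4N K` in the tree, `IsMetricOn.lieFormAt_metric_eq_of_kidK`), coupled to a second-order
equation for the lapse `N`. This file provides the two generic ingredients of the jet rigidity of
KIDs (`KIDChartJetRigidity.lean`):

* `KIDJetRigidity.two_mul_apply_fderiv_fderiv` — **the braid identity with a source**: for `C²`
  data `G` (symmetric forms), `X` and a differentiable source `S` with
  `DG_y(X y)(u,w) + G_y(DX_y u, w) + G_y(u, DX_y w) = S_y(u,w)` on an open set,
  `2 G_x(D²X_x(z,u), w) = -(T(z;u,w) + T(u;z,w) - T(w;z,u)) + (DS_x(z)(u,w) + DS_x(u)(z,w) - DS_x(w)(z,u))`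
  (Beig–Chruściel 1997, §2: the KID system prolongs to a closed first-order system);
* `KIDJetRigidity.exists_norm_fderiv_fderiv_le` — `‖D²X_x‖ ≤ C (‖X x‖ + ‖DX_x‖ + ‖DS_x‖)` near every
  nondegenerate point;
* `KIDJetRigidity.eventually_eq_zero_of_norm_fderiv_le`,
  **`KIDJetRigidity.eqOn_zero_of_isPreconnected_of_norm_fderiv_le`** — **Grönwall propagation**:
  a differentiable `u : E → F` on a preconnected open `s` with `‖Du_x‖ ≤ C ‖u x‖` locally near every
  point of `s`, vanishing at one point of `s`, vanishes on `s` (Grönwall along segments, then the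
  open–closed argument). Applied to the jet `u = (N, DN, X, DX)` of a KID this is Moncrief's rigidity.

## References

* B. O'Neill, *Semi-Riemannian geometry*, Academic Press 1983, Ch. 9, Lemma 9.28. [ONeill1983]
* R. M. Wald, *General Relativity*, 1984, App. C.3, (C.3.6)–(C.3.9). [Wald1984]
* R. Beig, P. T. Chruściel, Class. Quantum Grav. 14 (1997) A83–A92, §2; V. Moncrief, J. Math. Phys.
  16 (1975) 493–498, §III. [Moncrief1975]
-/

noncomputable section

set_option maxSynthPendingDepth 3

open Set Filter Module Function Metric

open scoped ContDiff Topology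

namespace Literature.Geometry.Lorentzian

namespace KIDJetRigidity

variable {E : Type*} [NormedAddCommGroup E] [NormedSpace ℝ E] [FiniteDimensional ℝ E]
  {G S : E → E →L[ℝ] E →L[ℝ] ℝ} {X : E → E} {s : Set E}

/-! ### The braid identity for the Killing equation with a source -/

omit [FiniteDimensional ℝ E] in
/-- **The braid (Koszul) identity for the coordinate Killing equation with a source.** Let `G`
(symmetric forms) and `X` be `C²` on the open set `s`, `S` differentiable on `s`, and
`𝓛_X G = S` on `s`, i.e. `DG_y(X y)(u, w) + G_y(DX_y u, w) + G_y(u, DX_y w) = S_y(u, w)`. Then at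
`x ∈ s`, for all `z, u, w`,
`2 G_x(D²X_x(z,u), w) = -(T(z;u,w) + T(u;z,w) - T(w;z,u)) + (DS_x(z)(u,w) + DS_x(u)(z,w) - DS_x(w)(z,u))`,
`T(z;u,w) = D²G_x(z, X x)(u,w) + DG_x(DX_x z)(u,w) + DG_x(z)(DX_x u, w) + DG_x(z)(u, DX_x w)`
(differentiate along `z` and braid; `S = 0` is `KillingJetRigidity.two_mul_apply_fderiv_fderiv`,
Wald 1984, (C.3.6); `S = −2αK` is the prolongation of the first KID equation, Beig–Chruściel 1997,
§2). [cite: Wald1984, App. C.3 (C.3.6)] -/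
theorem two_mul_apply_fderiv_fderiv (hs : IsOpen s) (hG : ContDiffOn ℝ 2 G s) (hX : ContDiffOn ℝ 2 X s)
    (hS : DifferentiableOn ℝ S s) (hsymm : ∀ y ∈ s, ∀ u w, G y u w = G y w u)
    (hK : ∀ y ∈ s, ∀ u w,
      fderiv ℝ G y (X y) u w + G y (fderiv ℝ X y u) w + G y u (fderiv ℝ X y w) = S y u w)
    {x : E} (hx : x ∈ s) (z u w : E) :
    2 * G x (fderiv ℝ (fderiv ℝ X) x z u) w =
      -((fderiv ℝ (fderiv ℝ G) x z (X x) u w + fderiv ℝ G x (fderiv ℝ X x z) u w +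
            fderiv ℝ G x z (fderiv ℝ X x u) w + fderiv ℝ G x z u (fderiv ℝ X x w)) +
          (fderiv ℝ (fderiv ℝ G) x u (X x) z w + fderiv ℝ G x (fderiv ℝ X x u) z w +
            fderiv ℝ G x u (fderiv ℝ X x z) w + fderiv ℝ G x u z (fderiv ℝ X x w)) -
          (fderiv ℝ (fderiv ℝ G) x w (X x) z u + fderiv ℝ G x (fderiv ℝ X x w) z u +
            fderiv ℝ G x w (fderiv ℝ X x z) u + fderiv ℝ G x w z (fderiv ℝ X x u))) +
        (fderiv ℝ S x z u w + fderiv ℝ S x u z w - fderiv ℝ S x w z u) := by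
  set X' : E → E →L[ℝ] E := fderiv ℝ X with hX'_def
  set X'' : E →L[ℝ] E →L[ℝ] E := fderiv ℝ X' x with hX''_def
  have hxs : s ∈ 𝓝 x := hs.mem_nhds hx
  have hXd : DifferentiableAt ℝ X x := (hX.differentiableOn two_ne_zero).differentiableAt hxs
  have hX'd : DifferentiableAt ℝ X' x :=
    ((hX.fderiv_of_isOpen hs (m := 1) (by norm_num)).differentiableOn one_ne_zero).differentiableAt hxs
  have hGd : DifferentiableAt ℝ G x := (hG.differentiableOn two_ne_zero).differentiableAt hxs
  have hSd : DifferentiableAt ℝ S x := hS.differentiableAt hxs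
  have hG'd : DifferentiableAt ℝ (fderiv ℝ G) x :=
    ((hG.fderiv_of_isOpen hs (m := 1) (by norm_num)).differentiableOn one_ne_zero).differentiableAt hxs
  have hsymm2 : ∀ v w, X'' v w = X'' w v := (hX.contDiffAt hxs).isSymmSndFDerivAt (by simp)
  have hsx : ∀ u w, G x u w = G x w u := hsymm x hx
  have hsym1 : ∀ z u w, fderiv ℝ G x z u w = fderiv ℝ G x z w u := by
    intro z u w
    rw [← OpensChart.fderiv_apply₂ G hGd, ← OpensChart.fderiv_apply₂ G hGd]
    have heq : (fun y ↦ G y u w) =ᶠ[𝓝 x] fun y ↦ G y w u := by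
      filter_upwards [hxs] with y hy
      exact hsymm y hy u w
    rw [heq.fderiv_eq]
  have hT : ∀ z u w : E,
      fderiv ℝ (fderiv ℝ G) x z (X x) u w + fderiv ℝ G x (X' x z) u w +
        (fderiv ℝ G x z (X' x u) w + G x (X'' z u) w) +
        (fderiv ℝ G x z u (X' x w) + G x u (X'' z w)) = fderiv ℝ S x z u w := by
    intro z u w
    have hu : HasFDerivAt (fun y ↦ X' y u) (X''.flip u) x := by
      simpa using hX'd.hasFDerivAt.clm_apply (hasFDerivAt_const u x)
    have hw : HasFDerivAt (fun y ↦ X' y w) (X''.flip w) x := by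
      simpa using hX'd.hasFDerivAt.clm_apply (hasFDerivAt_const w x)
    have h1 : HasFDerivAt (fun y ↦ fderiv ℝ G y (X y))
        ((fderiv ℝ G x).comp (X' x) + (fderiv ℝ (fderiv ℝ G) x).flip (X x)) x := by
      have h := hG'd.hasFDerivAt.clm_apply hXd.hasFDerivAt
      rwa [← hX'_def] at h
    have h1u : HasFDerivAt (fun y ↦ fderiv ℝ G y (X y) u)
        (((fderiv ℝ G x).comp (X' x) + (fderiv ℝ (fderiv ℝ G) x).flip (X x)).flip u) x := by
      simpa using h1.clm_apply (hasFDerivAt_const u x)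
    have h1uw : HasFDerivAt (fun y ↦ fderiv ℝ G y (X y) u w)
        ((((fderiv ℝ G x).comp (X' x) + (fderiv ℝ (fderiv ℝ G) x).flip (X x)).flip u).flip w) x := by
      simpa using h1u.clm_apply (hasFDerivAt_const w x)
    have h2 : HasFDerivAt (fun y ↦ G y (X' y u)) ((G x).comp (X''.flip u) + (fderiv ℝ G x).flip (X' x u)) x :=
      hGd.hasFDerivAt.clm_apply hu
    have h2w : HasFDerivAt (fun y ↦ G y (X' y u) w)
        (((G x).comp (X''.flip u) + (fderiv ℝ G x).flip (X' x u)).flip w) x := by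
      simpa using h2.clm_apply (hasFDerivAt_const w x)
    have h3 : HasFDerivAt (fun y ↦ G y u) ((fderiv ℝ G x).flip u) x := by
      simpa using hGd.hasFDerivAt.clm_apply (hasFDerivAt_const u x)
    have h3w : HasFDerivAt (fun y ↦ G y u (X' y w))
        ((G x u).comp (X''.flip w) + ((fderiv ℝ G x).flip u).flip (X' x w)) x :=
      h3.clm_apply hw
    have hsum := (h1uw.add h2w).add h3w
    have hS1 : HasFDerivAt (fun y ↦ S y u) ((fderiv ℝ S x).flip u) x := by
      simpa using hSd.hasFDerivAt.clm_apply (hasFDerivAt_const u x)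
    have hS2 : HasFDerivAt (fun y ↦ S y u w) (((fderiv ℝ S x).flip u).flip w) x := by
      simpa using hS1.clm_apply (hasFDerivAt_const w x)
    have hrhs : HasFDerivAt (fun y ↦ fderiv ℝ G y (X y) u w + G y (X' y u) w + G y u (X' y w))
        (((fderiv ℝ S x).flip u).flip w) x := by
      refine hS2.congr_of_eventuallyEq ?_
      filter_upwards [hxs] with y hy
      exact hK y hy u w
    have heq := hsum.unique hrhs
    have hz := DFunLike.congr_fun heq z
    simp only [add_apply, ContinuousLinearMap.comp_apply,
      ContinuousLinearMap.flip_apply] at hz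
    linarith
  have h1 := hT z u w
  have h2 := hT u z w
  have h3 := hT w z u
  rw [hsx u (X'' z w)] at h1
  rw [hsx z (X'' u w), hsymm2 u z] at h2
  rw [hsx z (X'' w u), hsymm2 w u, hsymm2 w z] at h3
  linarith


/-! ### Prolongation bound: `‖D²X‖ ≤ C (‖X‖ + ‖DX‖ + ‖DS‖)` near a nondegenerate point -/

omit [FiniteDimensional ℝ E] in
/-- `|T(z, u, w)| ≤ ‖T‖ ‖z‖ ‖u‖ ‖w‖` (local copy of the helper of `KillingChartJetRigidity.lean`). [folklore] -/
private theorem norm_apply₃_le (T : E →L[ℝ] E →L[ℝ] E →L[ℝ] ℝ) (z u w : E) :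
    ‖T z u w‖ ≤ ‖T‖ * ‖z‖ * ‖u‖ * ‖w‖ :=
  calc ‖T z u w‖ ≤ ‖T z u‖ * ‖w‖ := (T z u).le_opNorm w
    _ ≤ ‖T z‖ * ‖u‖ * ‖w‖ := by gcongr; exact (T z).le_opNorm u
    _ ≤ ‖T‖ * ‖z‖ * ‖u‖ * ‖w‖ := by gcongr; exact T.le_opNorm z

omit [FiniteDimensional ℝ E] in
/-- `|T(y, z, u, w)| ≤ ‖T‖ ‖y‖ ‖z‖ ‖u‖ ‖w‖`. [folklore] -/
private theorem norm_apply₄_le (T : E →L[ℝ] E →L[ℝ] E →L[ℝ] E →L[ℝ] ℝ) (y z u w : E) :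
    ‖T y z u w‖ ≤ ‖T‖ * ‖y‖ * ‖z‖ * ‖u‖ * ‖w‖ :=
  calc ‖T y z u w‖ ≤ ‖T y‖ * ‖z‖ * ‖u‖ * ‖w‖ := norm_apply₃_le (T y) z u w
    _ ≤ ‖T‖ * ‖y‖ * ‖z‖ * ‖u‖ * ‖w‖ := by gcongr; exact T.le_opNorm y

-- the quadruply iterated operator space of `D²G` needs one more level of pending instance synthesis
set_option maxSynthPendingDepth 4 in
set_option maxHeartbeats 800000 in
/-- **Prolongation bound with a source.** For `G` (symmetric forms) and `X` of class `C²` and `S`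
differentiable on the open set `s` with `𝓛_X G = S`, near every point `x₀ ∈ s` at which `G` is
nondegenerate there is a constant `C` with `‖D²X_x‖ ≤ C (‖X x‖ + ‖DX_x‖ + ‖DS_x‖)` (solve the braid
identity for `D²X` through the uniformly invertible pairing `G_x`). O'Neill 1983, Ch. 9, proof of
Lemma 9.28; Beig–Chruściel 1997, §2. [cite: ONeill1983, Ch. 9, Lemma 9.28] -/
theorem exists_norm_fderiv_fderiv_le (hs : IsOpen s) (hG : ContDiffOn ℝ 2 G s) (hX : ContDiffOn ℝ 2 X s)
    (hS : DifferentiableOn ℝ S s) (hsymm : ∀ y ∈ s, ∀ u w, G y u w = G y w u)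
    (hK : ∀ y ∈ s, ∀ u w,
      fderiv ℝ G y (X y) u w + G y (fderiv ℝ X y u) w + G y u (fderiv ℝ X y w) = S y u w)
    {x₀ : E} (hx₀ : x₀ ∈ s) (hnd : ∀ u, (∀ w, G x₀ u w = 0) → u = 0) :
    ∃ C : ℝ, ∀ᶠ x in 𝓝 x₀,
      ‖fderiv ℝ (fderiv ℝ X) x‖ ≤ C * (‖X x‖ + ‖fderiv ℝ X x‖ + ‖fderiv ℝ S x‖) := by
  have hxs : s ∈ 𝓝 x₀ := hs.mem_nhds hx₀
  have hGc : ContinuousAt G x₀ := (hG.continuousOn.continuousWithinAt hx₀).continuousAt hxs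
  obtain ⟨c, hc, hcU⟩ := KillingJetRigidity.exists_norm_le_mul_norm_apply hGc hnd
  have hG1 : ContDiffOn ℝ 1 (fderiv ℝ G) s := hG.fderiv_of_isOpen hs (m := 1) (by norm_num)
  have hG'c : ContinuousAt (fderiv ℝ G) x₀ := (hG1.continuousOn.continuousWithinAt hx₀).continuousAt hxs
  have hG''c : ContinuousAt (fderiv ℝ (fderiv ℝ G)) x₀ :=
    ((hG1.continuousOn_fderiv_of_isOpen hs le_rfl).continuousWithinAt hx₀).continuousAt hxs
  set A : ℝ := ‖fderiv ℝ G x₀‖ + 1 with hA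
  set B : ℝ := ‖fderiv ℝ (fderiv ℝ G) x₀‖ + 1 with hB
  have hA' : ∀ᶠ x in 𝓝 x₀, ‖fderiv ℝ G x‖ ≤ A := by
    have h := Metric.continuousAt_iff'.1 hG'c 1 one_pos
    filter_upwards [h] with x hx
    rw [dist_eq_norm] at hx
    have := norm_le_insert' (fderiv ℝ G x) (fderiv ℝ G x₀)
    linarith
  have hB' : ∀ᶠ x in 𝓝 x₀, ‖fderiv ℝ (fderiv ℝ G) x‖ ≤ B := by
    have h := Metric.continuousAt_iff'.1 hG''c 1 one_pos
    filter_upwards [h] with x hx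
    rw [dist_eq_norm] at hx
    have := norm_le_insert' (fderiv ℝ (fderiv ℝ G) x) (fderiv ℝ (fderiv ℝ G) x₀)
    linarith
  refine ⟨c * (3 * (B + 3 * A + 1)) / 2, ?_⟩
  filter_upwards [hcU, hA', hB', hxs] with x hcx hAx hBx hx
  have hA0 : 0 ≤ A := by positivity
  have hB0 : 0 ≤ B := by positivity
  set N : ℝ := ‖X x‖ + ‖fderiv ℝ X x‖ + ‖fderiv ℝ S x‖ with hN
  have hN0 : 0 ≤ N := by positivity
  have hXle : ‖X x‖ ≤ N := by
    rw [hN]; linarith [norm_nonneg (fderiv ℝ X x), norm_nonneg (fderiv ℝ S x)]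
  have hDle : ‖fderiv ℝ X x‖ ≤ N := by
    rw [hN]; linarith [norm_nonneg (X x), norm_nonneg (fderiv ℝ S x)]
  have hSle : ‖fderiv ℝ S x‖ ≤ N := by
    rw [hN]; linarith [norm_nonneg (X x), norm_nonneg (fderiv ℝ X x)]
  have hS' : ∀ z u w : E, |fderiv ℝ S x z u w| ≤ N * (‖z‖ * ‖u‖ * ‖w‖) := by
    intro z u w
    rw [← Real.norm_eq_abs]
    calc ‖fderiv ℝ S x z u w‖ ≤ ‖fderiv ℝ S x‖ * ‖z‖ * ‖u‖ * ‖w‖ := norm_apply₃_le _ z u w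
      _ ≤ N * ‖z‖ * ‖u‖ * ‖w‖ := by gcongr
      _ = N * (‖z‖ * ‖u‖ * ‖w‖) := by ring
  have hT : ∀ z u w : E,
      |fderiv ℝ (fderiv ℝ G) x z (X x) u w + fderiv ℝ G x (fderiv ℝ X x z) u w +
          fderiv ℝ G x z (fderiv ℝ X x u) w + fderiv ℝ G x z u (fderiv ℝ X x w)| ≤
        (B + 3 * A) * N * (‖z‖ * ‖u‖ * ‖w‖) := by
    intro z u w
    have hzuw : 0 ≤ ‖z‖ * ‖u‖ * ‖w‖ := by positivity
    have e1 : |fderiv ℝ (fderiv ℝ G) x z (X x) u w| ≤ B * N * (‖z‖ * ‖u‖ * ‖w‖) := by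
      rw [← Real.norm_eq_abs]
      calc ‖fderiv ℝ (fderiv ℝ G) x z (X x) u w‖
          ≤ ‖fderiv ℝ (fderiv ℝ G) x‖ * ‖z‖ * ‖X x‖ * ‖u‖ * ‖w‖ := norm_apply₄_le _ z (X x) u w
        _ ≤ B * ‖z‖ * N * ‖u‖ * ‖w‖ := by gcongr
        _ = B * N * (‖z‖ * ‖u‖ * ‖w‖) := by ring
    have e2 : |fderiv ℝ G x (fderiv ℝ X x z) u w| ≤ A * N * (‖z‖ * ‖u‖ * ‖w‖) := by
      rw [← Real.norm_eq_abs]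
      calc ‖fderiv ℝ G x (fderiv ℝ X x z) u w‖
          ≤ ‖fderiv ℝ G x‖ * ‖fderiv ℝ X x z‖ * ‖u‖ * ‖w‖ := norm_apply₃_le _ _ u w
        _ ≤ ‖fderiv ℝ G x‖ * (‖fderiv ℝ X x‖ * ‖z‖) * ‖u‖ * ‖w‖ := by
            gcongr; exact ContinuousLinearMap.le_opNorm _ _
        _ ≤ A * (N * ‖z‖) * ‖u‖ * ‖w‖ := by gcongr
        _ = A * N * (‖z‖ * ‖u‖ * ‖w‖) := by ring
    have e3 : |fderiv ℝ G x z (fderiv ℝ X x u) w| ≤ A * N * (‖z‖ * ‖u‖ * ‖w‖) := by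
      rw [← Real.norm_eq_abs]
      calc ‖fderiv ℝ G x z (fderiv ℝ X x u) w‖
          ≤ ‖fderiv ℝ G x‖ * ‖z‖ * ‖fderiv ℝ X x u‖ * ‖w‖ := norm_apply₃_le _ z _ w
        _ ≤ ‖fderiv ℝ G x‖ * ‖z‖ * (‖fderiv ℝ X x‖ * ‖u‖) * ‖w‖ := by
            gcongr; exact ContinuousLinearMap.le_opNorm _ _
        _ ≤ A * ‖z‖ * (N * ‖u‖) * ‖w‖ := by gcongr
        _ = A * N * (‖z‖ * ‖u‖ * ‖w‖) := by ring
    have e4 : |fderiv ℝ G x z u (fderiv ℝ X x w)| ≤ A * N * (‖z‖ * ‖u‖ * ‖w‖) := by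
      rw [← Real.norm_eq_abs]
      calc ‖fderiv ℝ G x z u (fderiv ℝ X x w)‖
          ≤ ‖fderiv ℝ G x‖ * ‖z‖ * ‖u‖ * ‖fderiv ℝ X x w‖ := norm_apply₃_le _ z u _
        _ ≤ ‖fderiv ℝ G x‖ * ‖z‖ * ‖u‖ * (‖fderiv ℝ X x‖ * ‖w‖) := by
            gcongr; exact ContinuousLinearMap.le_opNorm _ _
        _ ≤ A * ‖z‖ * ‖u‖ * (N * ‖w‖) := by gcongr
        _ = A * N * (‖z‖ * ‖u‖ * ‖w‖) := by ring
    calc |fderiv ℝ (fderiv ℝ G) x z (X x) u w + fderiv ℝ G x (fderiv ℝ X x z) u w +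
            fderiv ℝ G x z (fderiv ℝ X x u) w + fderiv ℝ G x z u (fderiv ℝ X x w)|
        ≤ B * N * (‖z‖ * ‖u‖ * ‖w‖) + A * N * (‖z‖ * ‖u‖ * ‖w‖) +
            A * N * (‖z‖ * ‖u‖ * ‖w‖) + A * N * (‖z‖ * ‖u‖ * ‖w‖) :=
          (abs_add_le _ _).trans (add_le_add ((abs_add_le _ _).trans (add_le_add
            ((abs_add_le _ _).trans (add_le_add e1 e2)) e3)) e4)
      _ = (B + 3 * A) * N * (‖z‖ * ‖u‖ * ‖w‖) := by ring
  -- the bound on the functional `w ↦ G_x(D²X(z,u), w)`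
  have hfun : ∀ z u : E, ‖G x (fderiv ℝ (fderiv ℝ X) x z u)‖ ≤
      3 * (B + 3 * A + 1) * N / 2 * (‖z‖ * ‖u‖) := by
    intro z u
    refine ContinuousLinearMap.opNorm_le_bound _ (by positivity) fun w ↦ ?_
    have h := two_mul_apply_fderiv_fderiv hs hG hX hS hsymm hK hx z u w
    have t1 := hT z u w
    have t2 := hT u z w
    have t3 := hT w z u
    have s1 := hS' z u w
    have s2 := hS' u z w
    have s3 := hS' w z u
    rw [show ‖u‖ * ‖z‖ * ‖w‖ = ‖z‖ * ‖u‖ * ‖w‖ by ring] at t2 s2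
    rw [show ‖w‖ * ‖z‖ * ‖u‖ = ‖z‖ * ‖u‖ * ‖w‖ by ring] at t3 s3
    have habs₁ := KillingJetRigidity.abs_neg_add_sub_le_three t1 t2 t3
    have habs₂ : |fderiv ℝ S x z u w + fderiv ℝ S x u z w - fderiv ℝ S x w z u| ≤
        3 * (N * (‖z‖ * ‖u‖ * ‖w‖)) := by
      have h := KillingJetRigidity.abs_neg_add_sub_le_three s1 s2 s3
      rwa [abs_neg] at h
    have habs : |2 * G x (fderiv ℝ (fderiv ℝ X) x z u) w| ≤
        3 * ((B + 3 * A) * N * (‖z‖ * ‖u‖ * ‖w‖)) + 3 * (N * (‖z‖ * ‖u‖ * ‖w‖)) := by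
      rw [h]
      exact (abs_add_le _ _).trans (add_le_add habs₁ habs₂)
    rw [abs_mul, abs_two] at habs
    rw [Real.norm_eq_abs]
    calc |G x (fderiv ℝ (fderiv ℝ X) x z u) w|
        ≤ (3 * ((B + 3 * A) * N * (‖z‖ * ‖u‖ * ‖w‖)) + 3 * (N * (‖z‖ * ‖u‖ * ‖w‖))) / 2 := by
          linarith
      _ = 3 * (B + 3 * A + 1) * N / 2 * (‖z‖ * ‖u‖) * ‖w‖ := by ring
  have hvec : ∀ z u : E,
      ‖fderiv ℝ (fderiv ℝ X) x z u‖ ≤ c * (3 * (B + 3 * A + 1) * N / 2) * (‖z‖ * ‖u‖) := by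
    intro z u
    calc ‖fderiv ℝ (fderiv ℝ X) x z u‖ ≤ c * ‖G x (fderiv ℝ (fderiv ℝ X) x z u)‖ := hcx _
      _ ≤ c * (3 * (B + 3 * A + 1) * N / 2 * (‖z‖ * ‖u‖)) := by gcongr; exact hfun z u
      _ = c * (3 * (B + 3 * A + 1) * N / 2) * (‖z‖ * ‖u‖) := by ring
  have hop : ‖fderiv ℝ (fderiv ℝ X) x‖ ≤ c * (3 * (B + 3 * A + 1) * N / 2) := by
    refine ContinuousLinearMap.opNorm_le_bound _ (by positivity) fun z ↦ ?_
    refine ContinuousLinearMap.opNorm_le_bound _ (by positivity) fun u ↦ ?_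
    calc ‖fderiv ℝ (fderiv ℝ X) x z u‖
        ≤ c * (3 * (B + 3 * A + 1) * N / 2) * (‖z‖ * ‖u‖) := hvec z u
      _ = c * (3 * (B + 3 * A + 1) * N / 2) * ‖z‖ * ‖u‖ := by ring
  calc ‖fderiv ℝ (fderiv ℝ X) x‖ ≤ c * (3 * (B + 3 * A + 1) * N / 2) := hop
    _ = c * (3 * (B + 3 * A + 1)) / 2 * N := by ring


/-! ### Grönwall propagation: a map with `‖Du‖ ≤ C ‖u‖` vanishing at a point vanishes -/

omit [FiniteDimensional ℝ E] in
/-- **Local Grönwall propagation.** If `u : E → F` is differentiable near `x₀` with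
`‖Du_x‖ ≤ C ‖u x‖` near `x₀` and `u x₀ = 0`, then `u = 0` near `x₀`: along every short segment
`t ↦ u(x₀ + t v)` solves `|y'| ≤ K |y|`, `y(0) = 0`, so Grönwall's inequality
(`norm_le_gronwallBound_of_norm_deriv_right_le`) forces `y = 0`. O'Neill 1983, Ch. 9, proof of
Lemma 9.28 (the ODE step). [cite: ONeill1983, Ch. 9, Lemma 9.28] -/
theorem eventually_eq_zero_of_norm_fderiv_le {F : Type*} [NormedAddCommGroup F] [NormedSpace ℝ F]
    {u : E → F} {x₀ : E} {C : ℝ} (hu : ∀ᶠ x in 𝓝 x₀, DifferentiableAt ℝ u x)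
    (hb : ∀ᶠ x in 𝓝 x₀, ‖fderiv ℝ u x‖ ≤ C * ‖u x‖) (h0 : u x₀ = 0) :
    ∀ᶠ x in 𝓝 x₀, u x = 0 := by
  obtain ⟨ρ, hρ, hball⟩ : ∃ ρ > 0,
      ball x₀ ρ ⊆ {x | DifferentiableAt ℝ u x} ∩ {x | ‖fderiv ℝ u x‖ ≤ C * ‖u x‖} :=
    Metric.mem_nhds_iff.1 (Filter.inter_mem hu hb)
  have hC : ∀ x ∈ ball x₀ ρ, ‖fderiv ℝ u x‖ ≤ max C 0 * ‖u x‖ := fun x hx ↦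
    (hball hx).2.trans (mul_le_mul_of_nonneg_right (le_max_left _ _) (norm_nonneg _))
  refine Filter.eventually_of_mem (ball_mem_nhds x₀ hρ) fun x hx ↦ ?_
  set v : E := x - x₀ with hv
  let γ : ℝ → E := fun t ↦ x₀ + t • v
  have hγd : ∀ t, HasDerivAt γ v t := fun t ↦ by
    have h := ((hasDerivAt_id t).smul_const v).const_add x₀
    rwa [one_smul] at h
  have hγball : ∀ t ∈ Icc (0 : ℝ) 1, γ t ∈ ball x₀ ρ := by
    intro t ht
    rw [mem_ball, dist_eq_norm]
    have hxv : ‖v‖ < ρ := by rwa [hv, ← dist_eq_norm, ← mem_ball]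
    calc ‖γ t - x₀‖ = ‖t • v‖ := by simp [γ]
      _ = |t| * ‖v‖ := norm_smul t v
      _ ≤ 1 * ‖v‖ := by gcongr; rw [abs_le]; constructor <;> linarith [ht.1, ht.2]
      _ < ρ := by rwa [one_mul]
  let Y : ℝ → F := fun t ↦ u (γ t)
  let Y' : ℝ → F := fun t ↦ fderiv ℝ u (γ t) v
  have hY : ∀ t ∈ Icc (0 : ℝ) 1, HasDerivAt Y (Y' t) t := fun t ht ↦
    (hball (hγball t ht)).1.hasFDerivAt.comp_hasDerivAt t (hγd t)
  have hYc : ContinuousOn Y (Icc 0 1) := fun t ht ↦ (hY t ht).continuousAt.continuousWithinAt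
  have hbound : ∀ t ∈ Ico (0 : ℝ) 1, ‖Y' t‖ ≤ max C 0 * ‖v‖ * ‖Y t‖ + 0 := by
    intro t ht
    have ht' : t ∈ Icc (0 : ℝ) 1 := ⟨ht.1, ht.2.le⟩
    rw [add_zero]
    calc ‖fderiv ℝ u (γ t) v‖ ≤ ‖fderiv ℝ u (γ t)‖ * ‖v‖ := ContinuousLinearMap.le_opNorm _ _
      _ ≤ max C 0 * ‖u (γ t)‖ * ‖v‖ :=
          mul_le_mul_of_nonneg_right (hC _ (hγball t ht')) (norm_nonneg v)
      _ = max C 0 * ‖v‖ * ‖Y t‖ := by ring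
  have hY0 : ‖Y 0‖ ≤ 0 := by simp [Y, γ, h0]
  have hgr := norm_le_gronwallBound_of_norm_deriv_right_le hYc
    (fun t ht ↦ (hY t ⟨ht.1, ht.2.le⟩).hasDerivWithinAt) hY0 hbound 1 ⟨zero_le_one, le_rfl⟩
  rw [gronwallBound_ε0_δ0] at hgr
  have hY1 : Y 1 = 0 := norm_le_zero_iff.1 hgr
  have hγ1 : γ 1 = x := by simp [γ, hv]
  simpa [Y, hγ1] using hY1

omit [FiniteDimensional ℝ E] in
/-- **Grönwall propagation on a preconnected open set.** Let `u : E → F` be differentiable on the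
preconnected open set `s`, with a local bound `‖Du_x‖ ≤ C ‖u x‖` near every point of `s`. If `u`
vanishes at one point of `s` then `u = 0` on `s` (the zero set of `u` is open by
`eventually_eq_zero_of_norm_fderiv_le` and relatively closed by continuity). O'Neill 1983, Ch. 9,
Lemma 9.28 (the open–closed step); Kobayashi–Nomizu I, Ch. VI, Thm. 3.3.
[cite: ONeill1983, Ch. 9, Lemma 9.28] -/
theorem eqOn_zero_of_isPreconnected_of_norm_fderiv_le {F : Type*} [NormedAddCommGroup F]
    [NormedSpace ℝ F] {u : E → F} (hs : IsOpen s) (hconn : IsPreconnected s)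
    (hu : DifferentiableOn ℝ u s)
    (hb : ∀ x₀ ∈ s, ∃ C : ℝ, ∀ᶠ x in 𝓝 x₀, ‖fderiv ℝ u x‖ ≤ C * ‖u x‖)
    {x₀ : E} (hx₀ : x₀ ∈ s) (h0 : u x₀ = 0) : ∀ x ∈ s, u x = 0 := by
  let Z : Set E := {x | ∀ᶠ y in 𝓝 x, u y = 0}
  have hZo : IsOpen Z := isOpen_setOf_eventually_nhds
  have hdiff : ∀ x ∈ s, ∀ᶠ y in 𝓝 x, DifferentiableAt ℝ u y := fun x hx ↦ by
    filter_upwards [hs.mem_nhds hx] with y hy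
    exact hu.differentiableAt (hs.mem_nhds hy)
  have hloc : ∀ x ∈ s, u x = 0 → x ∈ Z := fun x hx hx0 ↦ by
    obtain ⟨C, hC⟩ := hb x hx
    exact eventually_eq_zero_of_norm_fderiv_le (hdiff x hx) hC hx0
  have huc : ContinuousOn u s := hu.continuousOn
  have hsub : s ⊆ Z := by
    refine hconn.subset_of_closure_inter_subset hZo ⟨x₀, hx₀, hloc x₀ hx₀ h0⟩ ?_
    rintro x ⟨hxc, hx⟩
    have hfr : ∃ᶠ y in 𝓝 x, u y = 0 := by
      rw [mem_closure_iff_frequently] at hxc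
      exact hxc.mono fun y hy ↦ hy.self_of_nhds
    have hux : u x = 0 :=
      tendsto_nhds_unique_of_frequently_eq
        ((huc.continuousWithinAt hx).continuousAt (hs.mem_nhds hx)) tendsto_const_nhds hfr
    exact hloc x hx hux
  intro x hx
  exact (hsub hx).self_of_nhds

end KIDJetRigidity

end Literature.Geometry.Lorentzian

end
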